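/-
Copyright: the b2b-balaban T⁴-continuum CRUX team, row NE7b OWNER lineage `t4-ne7b-p1` (gen 127). Project licence.
-/
import Summits.QuantumFields.BalabanUV.T4Continuum.Spine.NE7b.SupFibreGaussianScaleSplit
import Summits.QuantumFields.BalabanUV.T4Continuum.Spine.NE7b.SupGaussianFiniteRangeDependence

/-!
# EACH SCALE OF THE FLUCTUATION FIELD IS A FINITE-RANGE-DEPENDENT REFERENCE FOR THE TREE'S POLYMER GAS: for (273)'s data and every
# scale `N`, the centred Gaussian chart field with covariance `c·C_N(cM_z)` ((280)'s `N`-th convolution factor of the fluctuation law)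
# and ANY grouping of the chart indices into cells, with the adjacency «some indices of the two cells are within chart distance
# `2(2^N − 1)(2r + R_H)`», satisfies the tree's `IsLocalPerturbation` for EVERY family of cell-measurable cell factors bounded by `ε ≥ 0`
# — (276) at `Γ = c·C_N`, (280)'s positivity and finite range; so `LocalPerturbationPolymerGas` ∕ `LocalPerturbationClusterExpansion`
# (polymer representation, zero-freeness, `‖log Z(C)‖ ≤ #C(Δ+1)2eε`) apply to the scale-`N` integration BY NAME (row NE7b, node U5c;
# (276)∕(280) BY NAME; [folklore])

Cell `pub-balaban`, sub-cell `t4`, spine estimate NE7b (`T4WeightBudget.RelWeightBound`; the cell's OWN estimate — NOT PRINTED in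
[Bałaban 1983–89], NOT PROVED).  Crux-route work under `Spine/NE7b/` by the row OWNER (`t4-ne7b-p1` gen 127, file (282)) under FREEZE
(0)'s crux-prover clause, on § [NE7bP1-G126-HANDOFF] NEXT (3)(d), at TEA's level; NOTHING of Bałaban's is named as a Lean object, valued or
asserted; no `T4Continuum/Support` leaf typed; no `def`, no notation; zero `sorry`.  Imports (BY NAME): the OWNER's (280)
`…SupFibreGaussianScaleSplit` (`scale_posSemidef`, `scale_hasFiniteRange`), (276) `…SupGaussianFiniteRangeDependence`
(`isLocalPerturbation_gaussian`, `gaussian_indep_of_not_touches`).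

WHY (located).  The by-name chain of the finite-range route is: fluctuation law = `✶_N N(0, c·C_N) ∗ N(0, last)` ((280)); each factor with
a finite-range covariance is a finite-range-dependent reference ((276)); the tree's polymer gas consumes exactly that.  This file is the
junction written out once, so a successor's scale-by-scale expansion starts from `IsLocalPerturbation` with no Gaussian bookkeeping left.

WHAT IS PROVED ([folklore]; (273)'s data, any scale `N`, any cells `cell : V → Finset σ`): **`scale_indep_of_not_touches`** (cell sets
that do not touch for the scale-`N` adjacency generate independent σ-algebras under `N(0, c·C_N)`), THE END **`scale_isLocalPerturbation`**
(every cell-measurable family `g` with `‖g_p‖ ≤ ε`, `ε ≥ 0`, is an `IsLocalPerturbation (multivariateGaussian 0 (c·C_N)) R_N 𝓕 g ε`); §2 toy.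

HONEST (what this is NOT).  Instantiation by name; the smallness of the road's actual cell factors and the Dobrushin∕KP threshold
`eε(Δ+1)² ≤ 1∕2` (with `Δ` the number of scale-`N` neighbours of a cell, growing like `2^{Nd}`) are the successor's — the place where the
sizes of the pieces must enter; scalar skeleton ((A3), NC-NE7b-α UNRULED); nothing of Bałaban's asserted.  BY-NAME EFFECT ON THE WALL:
NONE.  NE7b NOT PRINTED ∕ NOT PROVED; spine PROVED 0∕9; rung (B)+1 — the programme's measures remain FINITE-torus statements; NOT the mass gap,
NOT Clay.  HONEST DEPENDENCY: continuum YM on T⁴ ⇐ BetaPertH ∧ nine spine estimates (0∕9 proved); BetaPertH ⇐ (D1) ∧ (D4) ∧ CAP+tail;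
G-an2-4 gates asym, D1 and NE2∕3∕4.
-/

set_option autoImplicit false

noncomputable section

namespace Summit.QuantumFields.BalabanUV.T4Continuum.NE7b.SupFibreScaleReference

open MeasureTheory ProbabilityTheory Matrix
open Literature.Analysis.Matrix (HasFiniteRange frdPiece)
open Literature.Probability.LatticeModels (Touches IsLocalPerturbation)
open SupFibreGaussianScaleSplit (scale_posSemidef scale_hasFiniteRange)
open SupGaussianFiniteRangeDependence (isLocalPerturbation_gaussian gaussian_indep_of_not_touches)

variable {ι : Type*} [Fintype ι] {σ : Type} [Fintype σ] [DecidableEq σ] {V : Type*}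
  {H : (ι → ℝ) →L[ℝ] (ι → ℝ) →L[ℝ] ℝ} (P : (σ → ℝ) →L[ℝ] (ι → ℝ))
  {dι : ι → ι → ℕ} {home : σ → ι} {r RH : ℕ}

/-! ## §1. The scale-`N` chart field as a finite-range-dependent reference -/

omit [Fintype ι] in
/-- **THE SCALE-`N` FIELD HAS FINITE-RANGE DEPENDENCE ACROSS CELLS**: for (273)'s data, `c ≥ 0`, cells `cell : V → Finset σ` and the
scale-`N` adjacency «two cells have indices within chart distance `2(2^N − 1)(r + R_H + r)`», cell sets that do not touch generate independent
σ-algebras under `N(0, c·C_N(cM_z))`. [folklore] -/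
theorem scale_indep_of_not_touches [Fintype ι] (hHsym : ∀ h k : ι → ℝ, H h k = H k h)
    (htri : ∀ x y w, dι x w ≤ dι x y + dι y w) (hsym : ∀ x y, dι x y = dι y x) (hd0 : ∀ x, dι x x = 0)
    (hHloc : ∀ h k : ι → ℝ, (∀ x y, h x ≠ 0 → k y ≠ 0 → RH < dι x y) → H h k = 0)
    (hPloc : ∀ j x, r < dι (home j) x → P (Pi.single j 1) x = 0) (Mz : Matrix σ σ ℝ)
    (hMz : ∀ j k, Mz j k = H (P (Pi.single j 1)) (P (Pi.single k 1))) {c : ℝ} (hc : 0 ≤ c) (N : ℕ) (cell : V → Finset σ)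
    (K₁ K₂ : Finset V)
    (hKK : ¬ Touches (fun p p' : V => ∃ j ∈ cell p, ∃ k ∈ cell p', dι (home j) (home k) ≤ 2 * (2 ^ N - 1) * (r + RH + r)) K₁ K₂) :
    Indep (⨆ p ∈ K₁, MeasurableSpace.comap (fun (ω : EuclideanSpace ℝ σ) (x : cell p) => ω x) inferInstance)
      (⨆ p ∈ K₂, MeasurableSpace.comap (fun (ω : EuclideanSpace ℝ σ) (x : cell p) => ω x) inferInstance)
      (multivariateGaussian 0 (c • frdPiece (c • Mz) N)) :=
  gaussian_indep_of_not_touches (scale_posSemidef P hHsym Mz hMz hc N) 0 cell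
    (scale_hasFiniteRange P htri hsym hd0 hHloc hPloc Mz hMz c N)
    (fun _ _ j k hj hk hle => Or.inr ⟨j, hj, k, hk, hle⟩) K₁ K₂ hKK

omit [Fintype ι] in
/-- **HEADLINE — THE SCALE-`N` INTEGRATION IS A LOCAL PERTURBATION OF A FINITE-RANGE-DEPENDENT REFERENCE.**  For (273)'s data (`H` symmetric
of range `R_H` in the bilinear sense for a symmetric pseudo-distance `dι`, chart local with radius `r`), `c ≥ 0`, a scale `N`, ANY cells
`cell : V → Finset σ`, and ANY family of cell factors `g_p` measurable for the cell σ-algebras with `‖g_p‖ ≤ ε`, `ε ≥ 0`: the centred Gaussian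
chart field with covariance `c·C_N(cM_z)` carries `IsLocalPerturbation` with the scale-`N` adjacency — the hypothesis of the tree's
`LocalPerturbationPolymerGas` ∕ `LocalPerturbationClusterExpansion`. [folklore] -/
theorem scale_isLocalPerturbation [Fintype ι] (hHsym : ∀ h k : ι → ℝ, H h k = H k h)
    (htri : ∀ x y w, dι x w ≤ dι x y + dι y w) (hsym : ∀ x y, dι x y = dι y x) (hd0 : ∀ x, dι x x = 0)
    (hHloc : ∀ h k : ι → ℝ, (∀ x y, h x ≠ 0 → k y ≠ 0 → RH < dι x y) → H h k = 0)
    (hPloc : ∀ j x, r < dι (home j) x → P (Pi.single j 1) x = 0) (Mz : Matrix σ σ ℝ)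
    (hMz : ∀ j k, Mz j k = H (P (Pi.single j 1)) (P (Pi.single k 1))) {c : ℝ} (hc : 0 ≤ c) (N : ℕ) (cell : V → Finset σ)
    (g : V → EuclideanSpace ℝ σ → ℂ) {ε : ℝ} (hε : 0 ≤ ε)
    (hmeas : ∀ p, Measurable[MeasurableSpace.comap (fun (ω : EuclideanSpace ℝ σ) (x : cell p) => ω x) inferInstance] (g p))
    (hbound : ∀ p ω, ‖g p ω‖ ≤ ε) :
    IsLocalPerturbation (multivariateGaussian 0 (c • frdPiece (c • Mz) N))
      (fun p p' : V => ∃ j ∈ cell p, ∃ k ∈ cell p', dι (home j) (home k) ≤ 2 * (2 ^ N - 1) * (r + RH + r))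
      (fun p => MeasurableSpace.comap (fun (ω : EuclideanSpace ℝ σ) (x : cell p) => ω x) inferInstance) g ε :=
  isLocalPerturbation_gaussian (scale_posSemidef P hHsym Mz hMz hc N) 0 cell
    (scale_hasFiniteRange P htri hsym hd0 hHloc hPloc Mz hMz c N)
    (fun _ _ j k hj hk hle => Or.inr ⟨j, hj, k, hk, hle⟩) g hε hmeas hbound

/-! ## §2. Toy -/

/-- Toy: the scale-`N` adjacency is reflexive on a nonempty cell (distance `0` from an index to itself), so a single cell never counts as «not
touching» itself — the polymer gas's hard core. -/
example {V : Type*} (cell : V → Finset (Fin 2)) (p : V) (N : ℕ) :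
    Touches (fun p p' : V => ∃ j ∈ cell p, ∃ k ∈ cell p', (fun _ _ : Fin 2 => (0 : ℕ)) j k ≤ 2 * (2 ^ N - 1) * (0 + 1 + 0)) {p} {p} :=
  ⟨p, Finset.mem_singleton_self p, p, Finset.mem_singleton_self p, Or.inl rfl⟩

end Summit.QuantumFields.BalabanUV.T4Continuum.NE7b.SupFibreScaleReference
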